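import Literature.Geometry.Lorentzian.KerrConvergence
import HarnessLib

/-!
# `BulkKerrCaptureC2` — junk-exclusion for the region witness (refuter, crux attack 2026-08-17)

The conclusion of the crux `Theses.PhaseMixingCapture.BulkKerrCaptureC2` (stmt-FinalStateConjecture-14985)
asks `∃ (M' a' : ℝ) (𝒟oc : Set 𝒟.carrier), … ∧ 𝒟.toSpacetime.ConvergesToKerr 𝒟oc M' a' 2 ∧ …` with the
region `𝒟oc` existential. This file certifies that the existential cannot be discharged by the junk
witness `𝒟oc = ∅`: the Kerr late region `{t* > τ₀, r > max r₊ 0}` is nonempty for ALL real `M, a, τ₀`,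
and a late-time chart maps it into the region, so every region to which a spacetime converges is
nonempty. (Negative-side helper; asserts no Theses statement.)
-/

-- the doubled `FinalStateConjecture.FinalStateConjecture` path component trips dupNamespace
set_option linter.dupNamespace false

noncomputable section

open Set
open Literature.Geometry.Lorentzian

namespace Summit.FinalStateConjecture.FinalStateConjecture.Theorems.BulkKerrCaptureC2.Negative

/-- The Kerr late region `{x ∈ Kerr.exterior M a | τ₀ < t*(x)}` is nonempty for every real
`M, a, τ₀`: the axis-free point `(τ₀ + 1, R, 0, 0)` with `R = max r₊ 0 + |a| + 1` has Kerr–Schild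
radius `> max r₊ 0` (its square is at least `ρ² − a² = R² − a²`, Visser arXiv:0706.0622, (35)).
[folklore] -/
theorem lateRegion_nonempty (M a τ₀ : ℝ) : (Kerr.lateRegion M a τ₀).Nonempty := by
  set m : ℝ := max (Kerr.rPlus M a) 0 with hm
  have hm0 : 0 ≤ m := le_max_right _ _
  set R : ℝ := m + |a| + 1 with hR
  have hR0 : 0 ≤ R := by positivity
  let y : E3 := EuclideanSpace.single 0 R
  have hy : ‖y‖ = R := by
    simp [y, abs_of_nonneg hR0]
  let x : E4 := E4.ofTimeSpace (τ₀ + 1) y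
  have hρ : E4.spatialNorm x = R := by
    simp [x, hy]
  have hrad : m < Kerr.radius a x := by
    have h1 : m ^ 2 < E4.spatialNorm x ^ 2 - a ^ 2 := by
      rw [hρ, hR]
      nlinarith [abs_nonneg a, sq_abs a]
    -- `r² ≥ ρ² − a²` (Visser (35): `r² = ((ρ² − a²) + √((ρ² − a²)² + 4a²z²))/2`; the landed
    -- `…AdiabaticMultiKerrILED.Sketch.spatialNorm_sq_sub_sq_le_radius_sq'` lives in a foreign cone)
    have hle : E4.spatialNorm x ^ 2 - a ^ 2 ≤ Kerr.radius a x ^ 2 := by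
      rw [Kerr.radius_sq]
      have h := Kerr.abs_le_sqrt_radius_discr a x
      have h' := le_abs_self (E4.spatialNorm x ^ 2 - a ^ 2)
      linarith
    have h2 : m ^ 2 < Kerr.radius a x ^ 2 := h1.trans_le hle
    exact lt_of_pow_lt_pow_left₀ 2 (Kerr.radius_nonneg a x) h2
  have hx : x ∈ Kerr.exterior M a := by
    rw [Kerr.mem_exterior]
    exact hrad
  refine ⟨⟨x, hx⟩, ?_⟩
  rw [Kerr.mem_lateRegion]
  show τ₀ < E4.ofTimeSpace (τ₀ + 1) y 0
  rw [E4.ofTimeSpace_apply_zero]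
  linarith

/-- **Every region to which a spacetime converges (to some Kerr `g_{M,a}`, in any `Cᵏ`) is
nonempty**: the late-time chart maps the nonempty Kerr late region into it
(`IsLateChart.image_subset`). [folklore] -/
theorem nonempty_of_convergesToKerr {𝓢 : Spacetime 4} {𝒟 : Set 𝓢.carrier} {M a : ℝ} {k : ℕ}
    (h : 𝓢.ConvergesToKerr 𝒟 M a k) : 𝒟.Nonempty := by
  obtain ⟨τ₀, Ψ, hΨ, -⟩ := h
  obtain ⟨x, hx⟩ := lateRegion_nonempty M a τ₀
  exact ⟨Ψ x, hΨ.image_subset (mem_image_of_mem Ψ hx)⟩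

/-- **The empty region is not a witness**: no spacetime converges to any Kerr exterior on `∅`
(so the existential `𝒟oc` of `BulkKerrCaptureC2` carries content). [folklore] -/
theorem not_convergesToKerr_empty (𝓢 : Spacetime 4) (M a : ℝ) (k : ℕ) :
    ¬ 𝓢.ConvergesToKerr ∅ M a k := fun h ↦
  Set.not_nonempty_empty (nonempty_of_convergesToKerr h)

end Summit.FinalStateConjecture.FinalStateConjecture.Theorems.BulkKerrCaptureC2.Negative

end
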